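import Summits.QuantumFields.YangMills.Theorems.Instrument.PlaquetteLinkGeometry
import HarnessLib

/-!
# Instrument cell `ym-instrument`, crew (b): NO (G1) polymer with three plaquettes — `freePolymerCount f 3 = 0` (the cube-corner parity obstruction of RADIUS-DERIVATION (7.2),
# typed): census zero lifting the (G1) engine `KPCriterionFreeSU2Unconditional.kpCriterionFreeSU2_of_t2` to vanishing order `n₀ = 4`

QUESTIONS.md: Q-B2 ∕ J-B2a (S2-SPEC v0.5.1 (G3) head zeros `N_α(1) = N_α(2) = N_α(3) = 0`; RADIUS-DERIVATION v0.6.1 (7.2): «three pairwise link-adjacent plaquettes are three faces at a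
cube corner x, and the axis∕free parity conditions on their six outer links contradict each other»; sc-ref re-derivation 2026-08-27T01:12:50Z); cell `run/shared/lean/pub/ym-instrument/`,
HUMAN RULING D-0084 (2), director-ym R138.  HONEST FRAMING (page 1, binding).  WHAT IS CERTIFIED HERE AND AT WHICH `(G, D, L, β)`: PURE COMBINATORICS of `ℤ⁴` in the `b = 2` comb
gauge (`FreeLinkPolymerDefs.IsAxisLink ∕ IsFreeLink`): (§1) no plaquette contains two parallel links one lattice step apart IN THEIR OWN direction (`not_mem_parallel_shift`); a plaquette
one of whose two `a`-links is an axis link has all coordinates transverse to its plane even (`even_of_axis_pair`); (§2) in an admissible (every free link `≥ 2`-covered) plaquette set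
with exactly three members, every member has at most one free link per direction, hence exactly one (`axis_or_axis_of_three`); (§3) ★ `freePolymerCount f 3 = 0` for every link `f`
(`freePolymerCount_three`): for a member `p = (x; i, j)` the host `q` of its free `i`-link is the translate `p ± e_j` (any other host would have an odd transverse coordinate), the
free `j`-link of `q` is the `± e_j`-translate of the free `j`-link of `p`, and both would have to lie in the third member — two parallel `j`-links one step apart in direction `j`,
impossible.  With `PlaquetteLinkGeometry.freePolymerCount_eq_zero_of_le_two`: `freePolymerCount f n = 0` for all `n ≤ 3` (`freePolymerCount_eq_zero_of_le_three`).  The first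
non-zero count `N_α(4; f) = 1` (the four tiles of a block face) is NOT typed.  NOT a statement about any gauge theory, NOT a radius, NOT summit-bearing.  Grade (T).
-/

noncomputable section

open Finset
open Literature.MathematicalPhysics.QuantumLattice (ZdEdge ZdPlaquette plaquetteEdges)
open Literature.MathematicalPhysics.QuantumFieldTheory (mk_mem_plaquetteEdges_iff single_index_injective single_add_single_ne_zero add_single_ne_self)
open Literature.MathematicalPhysics.QuantumFieldTheory.Balaban1983to89.StrongCouplingKPWindow (links)
open Literature.Probability.LatticeModels (Site)
open Summit.QuantumFields.YangMills.Theorems.Instrument.AdmissibleLinkComplexCount (IsAdmConnected)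
open Summit.QuantumFields.YangMills.Theorems.Instrument.ClosedComplexExploration (atLink)
open Summit.QuantumFields.YangMills.Theorems.Instrument.ClosedComplexTailBound (AdmClosed)
open Summit.QuantumFields.YangMills.Theorems.Instrument.FreeLinkPolymerDefs (IsAxisLink IsFreeLink freePolymerCount)
open Summit.QuantumFields.YangMills.Theorems.Instrument.PlaquetteLinkGeometry
  (eq_of_mem_plaquetteEdges_of_ne not_isAxisLink_both freePolymerCount_eq_zero_of_le_two add_single_add_single_ne)

namespace Summit.QuantumFields.YangMills.Theorems.Instrument.FreePolymerThreeZero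

/-! ## §1 Two parallel links one step apart in their own direction; parity of a plaquette with an axis link -/

/-- No plaquette of `ℤ^d` contains both `(w, j)` and `(w + e_j, j)` (its two `j`-links differ by a unit vector in its OTHER direction). [folklore] -/
theorem not_mem_parallel_shift {d : ℕ} (r : ZdPlaquette d) (w : Site d) (j : Fin d) :
    ¬ (((w, j) : ZdEdge d) ∈ plaquetteEdges r ∧ ((w + Pi.single j 1, j) : ZdEdge d) ∈ plaquetteEdges r) := by
  rintro ⟨h1, h2⟩
  obtain ⟨y, ⟨⟨a, b⟩, hab⟩⟩ := r
  have hab' : a ≠ b := ne_of_lt hab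
  rw [mk_mem_plaquetteEdges_iff] at h1 h2
  dsimp only at h1 h2
  -- in either direction case the two base points lie in `{y, y + e_c}` with `c ≠ j`, but differ by `e_j`
  have key : ∀ c : Fin d, c ≠ j → (w = y ∨ w = y + Pi.single c 1) → (w + Pi.single j 1 = y ∨ w + Pi.single j 1 = y + Pi.single c 1) → False := by
    intro c hcj hw hw'
    rcases hw with rfl | rfl <;> rcases hw' with h | h
    · exact add_single_ne_self _ j h
    · exact hcj (single_index_injective (add_left_cancel h)).symm
    · exact add_single_add_single_ne _ c j h
    · rw [add_assoc, add_comm (Pi.single c 1), ← add_assoc] at h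
      exact add_single_ne_self _ j (add_right_cancel h)
  rcases h1 with ⟨rfl, hw⟩ | ⟨rfl, hw⟩ <;> rcases h2 with ⟨h, hw'⟩ | ⟨h, hw'⟩
  · exact key b (fun hb => hab' hb.symm) hw hw'
  · exact hab' h.symm
  · exact hab' h
  · exact key a hab' hw.symm hw'.symm

/-- If one of the two `a`-links `(y, a)`, `(y + e_b, a)` of the plaquette `(y; a, b)` (or `(y; b, a)`) is an axis link, then every coordinate of `y` transverse to `{a, b}` is even.
[folklore] -/
theorem even_of_axis_pair {y : Site 4} {a b : Fin 4} (h : IsAxisLink (y, a) ∨ IsAxisLink (y + Pi.single b 1, a)) {ν : Fin 4} (hνa : ν ≠ a) (hνb : ν ≠ b) : Even (y ν) := by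
  rcases h with h | h
  · exact h ν hνa
  · have := h ν hνa
    dsimp only at this
    rwa [Pi.add_apply, Pi.single_eq_of_ne hνb, add_zero] at this

/-! ## §2 In an admissible triple every member has exactly one free link per direction -/

/-- In a plaquette set `X` closed on its free links, every free link of a member `p` lies in a second member. [folklore] -/
theorem exists_host {X : Finset (ZdPlaquette 4)} (hcl : AdmClosed IsFreeLink X) {p : ZdPlaquette 4} (hp : p ∈ X) {g : ZdEdge 4} (hg : g ∈ plaquetteEdges p)
    (hfree : IsFreeLink g) : ∃ q ∈ X, q ≠ p ∧ g ∈ plaquetteEdges q := by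
  have two : 2 ≤ (atLink X g).card := hcl g (mem_biUnion.2 ⟨p, hp, hg⟩) hfree
  obtain ⟨q, hq, hqp⟩ := Finset.exists_mem_ne (lt_of_lt_of_le one_lt_two two) p
  exact ⟨q, (mem_filter.1 hq).1, hqp, (mem_filter.1 hq).2⟩

/-- ★ In a THREE-element plaquette set closed on its free links, a member `p` cannot have three distinct free links (each would need its own host among the two other
members, and a host of two of them would equal `p`).  Stated for the two parallel `a`-links plus one more link. [folklore] -/
theorem not_three_free {X : Finset (ZdPlaquette 4)} (h3 : X.card = 3) (hcl : AdmClosed IsFreeLink X) {p : ZdPlaquette 4} (hp : p ∈ X) {g₁ g₂ g₃ : ZdEdge 4}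
    (h₁ : g₁ ∈ plaquetteEdges p) (h₂ : g₂ ∈ plaquetteEdges p) (h₃ : g₃ ∈ plaquetteEdges p) (h12 : g₁ ≠ g₂) (h13 : g₁ ≠ g₃) (h23 : g₂ ≠ g₃)
    (f₁ : IsFreeLink g₁) (f₂ : IsFreeLink g₂) (f₃ : IsFreeLink g₃) : False := by
  classical
  obtain ⟨q₁, hq₁, hq₁p, hg₁⟩ := exists_host hcl hp h₁ f₁
  obtain ⟨q₂, hq₂, hq₂p, hg₂⟩ := exists_host hcl hp h₂ f₂
  obtain ⟨q₃, hq₃, hq₃p, hg₃⟩ := exists_host hcl hp h₃ f₃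
  -- the three hosts are pairwise distinct (a common host shares two links with `p`)
  have h12' : q₁ ≠ q₂ := fun h => hq₁p (eq_of_mem_plaquetteEdges_of_ne h12 hg₁ (h ▸ hg₂) h₁ h₂)
  have h13' : q₁ ≠ q₃ := fun h => hq₁p (eq_of_mem_plaquetteEdges_of_ne h13 hg₁ (h ▸ hg₃) h₁ h₃)
  have h23' : q₂ ≠ q₃ := fun h => hq₂p (eq_of_mem_plaquetteEdges_of_ne h23 hg₂ (h ▸ hg₃) h₂ h₃)
  -- so `p, q₁, q₂, q₃` are four distinct members of the 3-set `X`
  have hsub : ({p, q₁, q₂, q₃} : Finset (ZdPlaquette 4)) ⊆ X := by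
    intro s hs; simp only [mem_insert, mem_singleton] at hs
    rcases hs with rfl | rfl | rfl | rfl <;> assumption
  have hcard : ({p, q₁, q₂, q₃} : Finset (ZdPlaquette 4)).card = 4 := by
    rw [card_insert_of_notMem, card_insert_of_notMem, card_insert_of_notMem, card_singleton]
    · simpa using h23'
    · simp only [mem_insert, mem_singleton, not_or]; exact ⟨h12', h13'⟩
    · simp only [mem_insert, mem_singleton, not_or]; exact ⟨hq₁p.symm, hq₂p.symm, hq₃p.symm⟩
  have := card_le_card hsub
  omega

/-- ★ In a THREE-element plaquette set closed on its free links, for every member `(y; a, b)` one of the two `a`-links `(y, a)`, `(y + e_b, a)` is an axis link, and likewise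
one of the two `b`-links `(y, b)`, `(y + e_a, b)`. [folklore] -/
theorem axis_or_axis_of_three {X : Finset (ZdPlaquette 4)} (h3 : X.card = 3) (hcl : AdmClosed IsFreeLink X) {y : Site 4} {a b : Fin 4} {hab : a < b}
    (hp : ((y, ⟨(a, b), hab⟩) : ZdPlaquette 4) ∈ X) :
    (IsAxisLink (y, a) ∨ IsAxisLink (y + Pi.single b 1, a)) ∧ (IsAxisLink (y, b) ∨ IsAxisLink (y + Pi.single a 1, b)) := by
  have hab' : a ≠ b := ne_of_lt hab
  have hm : ∀ e : ZdEdge 4, e = (y, a) ∨ e = (y + Pi.single a 1, b) ∨ e = (y + Pi.single b 1, a) ∨ e = (y, b) →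
      e ∈ plaquetteEdges ((y, ⟨(a, b), hab⟩) : ZdPlaquette 4) := fun e he => by
    simp only [plaquetteEdges, mem_insert, mem_singleton]; exact he
  have m1 := hm (y, a) (Or.inl rfl)
  have m2 := hm (y + Pi.single a 1, b) (Or.inr (Or.inl rfl))
  have m3 := hm (y + Pi.single b 1, a) (Or.inr (Or.inr (Or.inl rfl)))
  have m4 := hm (y, b) (Or.inr (Or.inr (Or.inr rfl)))
  -- distinctness of the four links
  have d13 : ((y, a) : ZdEdge 4) ≠ (y + Pi.single b 1, a) := fun h => add_single_ne_self y b (Prod.mk.inj h).1.symm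
  have d14 : ((y, a) : ZdEdge 4) ≠ (y, b) := fun h => hab' (Prod.mk.inj h).2
  have d12 : ((y, a) : ZdEdge 4) ≠ (y + Pi.single a 1, b) := fun h => hab' (Prod.mk.inj h).2
  have d34 : ((y + Pi.single b 1, a) : ZdEdge 4) ≠ (y, b) := fun h => hab' (Prod.mk.inj h).2
  have d32 : ((y + Pi.single b 1, a) : ZdEdge 4) ≠ (y + Pi.single a 1, b) := fun h => hab' (Prod.mk.inj h).2
  have d42 : ((y, b) : ZdEdge 4) ≠ (y + Pi.single a 1, b) := fun h => add_single_ne_self y a (Prod.mk.inj h).1.symm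
  -- not both `a`-links axis, not both `b`-links axis (parity)
  have na := not_isAxisLink_both y hab'
  have nb := not_isAxisLink_both y (Ne.symm hab')
  constructor
  · by_contra h
    rw [not_or] at h
    -- both `a`-links free; one `b`-link is free too ⇒ three free links
    by_cases hb : IsAxisLink (y, b)
    · have f2 : IsFreeLink (y + Pi.single a 1, b) := fun h' => nb ⟨hb, h'⟩
      exact not_three_free h3 hcl hp m1 m3 m2 d13 d12 d32 h.1 h.2 f2
    · exact not_three_free h3 hcl hp m1 m3 m4 d13 d14 d34 h.1 h.2 hb
  · by_contra h
    rw [not_or] at h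
    by_cases ha : IsAxisLink (y, a)
    · have f3 : IsFreeLink (y + Pi.single b 1, a) := fun h' => na ⟨ha, h'⟩
      exact not_three_free h3 hcl hp m4 m2 m3 d42 d34.symm d32.symm h.1 h.2 f3
    · exact not_three_free h3 hcl hp m4 m2 m1 d42 d14.symm d12.symm h.1 h.2 ha

/-! ## §3 ★ No (G1) polymer with three plaquettes -/

/-- The free `a`-link of a plaquette `(y; a, b)` one of whose `a`-links is axis: it is `(y + ε e_b, a)` with `y_b + ε` odd; we record the form «there is `z ∈ {y, y + e_b}` with
`(z, a)` free, in the plaquette, and `z_b` odd, `z_ν = y_ν` for `ν ≠ b`». [folklore] -/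
theorem free_link_of_axis_pair {y : Site 4} {a b : Fin 4} (hab : a ≠ b) (h : IsAxisLink (y, a) ∨ IsAxisLink (y + Pi.single b 1, a)) :
    ∃ z : Site 4, (z = y ∨ z = y + Pi.single b 1) ∧ IsFreeLink (z, a) ∧ Odd (z b) := by
  have nb := not_isAxisLink_both y hab
  rcases h with h | h
  · refine ⟨y + Pi.single b 1, Or.inr rfl, fun h' => nb ⟨h, h'⟩, ?_⟩
    have he : Even (y b) := h b (Ne.symm hab)
    rw [Pi.add_apply, Pi.single_eq_same]
    exact he.add_one
  · refine ⟨y, Or.inl rfl, fun h' => nb ⟨h', h⟩, ?_⟩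
    have he : Even ((y + Pi.single b 1 : Site 4) b) := h b (Ne.symm hab)
    rw [Pi.add_apply, Pi.single_eq_same] at he
    rcases Int.even_or_odd (y b) with hy | hy
    · exact absurd he (Int.not_even_iff_odd.2 (hy.add_one))
    · exact hy

/-- ★ **`freePolymerCount f 3 = 0` for every link `f`** (cube-corner parity obstruction). [folklore] -/
theorem freePolymerCount_three (f : ZdEdge 4) : freePolymerCount f 3 = 0 := by
  classical
  unfold freePolymerCount
  haveI : IsEmpty {X : Finset (ZdPlaquette 4) // X.card = 3 ∧ f ∈ links X ∧ IsAdmConnected IsFreeLink X ∧ AdmClosed IsFreeLink X} :=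
    ⟨fun ⟨X, h3, hf, _, hcl⟩ => by
      -- a member `p = (x; i, j)`
      obtain ⟨p, hpX, -⟩ := mem_biUnion.1 hf
      obtain ⟨x, ⟨⟨i, j⟩, hij⟩⟩ := p
      have hij' : i ≠ j := ne_of_lt hij
      have hijN : (i : ℕ) < j := hij
      obtain ⟨hpi, hpj⟩ := axis_or_axis_of_three h3 hcl hpX
      -- transverse coordinates of `x` are even
      have hxe : ∀ ν : Fin 4, ν ≠ i → ν ≠ j → Even (x ν) := fun ν hνi hνj => even_of_axis_pair hpi hνi hνj
      -- the free `i`-link `g₁ = (z, i)` of `p`, `z ∈ {x, x + e_j}`, `z_j` odd; and the free `j`-link `g₂ = (w, j)`, `w ∈ {x, x + e_i}`, `w_i` odd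
      obtain ⟨z, hz, fz, hzodd⟩ := free_link_of_axis_pair hij' hpi
      obtain ⟨w, hw, fw, hwodd⟩ := free_link_of_axis_pair (Ne.symm hij') hpj
      have mz : ((z, i) : ZdEdge 4) ∈ plaquetteEdges ((x, ⟨(i, j), hij⟩) : ZdPlaquette 4) := by
        simp only [plaquetteEdges, mem_insert, mem_singleton]
        rcases hz with rfl | rfl
        · exact Or.inl rfl
        · exact Or.inr (Or.inr (Or.inl rfl))
      have mw : ((w, j) : ZdEdge 4) ∈ plaquetteEdges ((x, ⟨(i, j), hij⟩) : ZdPlaquette 4) := by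
        simp only [plaquetteEdges, mem_insert, mem_singleton]
        rcases hw with rfl | rfl
        · exact Or.inr (Or.inr (Or.inr rfl))
        · exact Or.inr (Or.inl rfl)
      -- hosts: `q ∋ (z, i)`, `r ∋ (w, j)`, both `≠ p`, and `q ≠ r`
      obtain ⟨q, hqX, hqp, hzq⟩ := exists_host hcl hpX mz fz
      obtain ⟨r, hrX, hrp, hwr⟩ := exists_host hcl hpX mw fw
      have hzw : ((z, i) : ZdEdge 4) ≠ (w, j) := fun h => hij' (Prod.mk.inj h).2
      have hqr : q ≠ r := fun h => hqp (eq_of_mem_plaquetteEdges_of_ne hzw hzq (h ▸ hwr) mz mw)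
      -- STEP 1: `q` lies in the plane `{i, j}` with base `x ± e_j`: write `q = (y; a, b)` and use the parity of its transverse coordinates
      obtain ⟨y, ⟨⟨a, b⟩, hab⟩⟩ := q
      have habN : (a : ℕ) < b := hab
      obtain ⟨hqa, hqb⟩ := axis_or_axis_of_three h3 hcl hqX
      have hye : ∀ ν : Fin 4, ν ≠ a → ν ≠ b → Even (y ν) := fun ν hνa hνb => even_of_axis_pair hqa hνa hνb
      have hzq' := hzq
      rw [mk_mem_plaquetteEdges_iff] at hzq'
      dsimp only at hzq'
      -- `z_j` is odd, `z` and `y` have the same `j`-coordinate unless the plane of `q` contains `j`; so `{a, b} = {i, j}`, i.e. `a = i`, `b = j`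
      have hzj_y : a ≠ j → b ≠ j → False := fun haj hbj => by
        have hyj : Even (y j) := hye j (Ne.symm haj) (Ne.symm hbj)
        rcases hzq' with ⟨-, rfl | rfl⟩ | ⟨-, rfl | rfl⟩
        · exact Int.not_odd_iff_even.2 hyj hzodd
        · rw [Pi.add_apply, Pi.single_eq_of_ne (Ne.symm hbj), add_zero] at hzodd; exact Int.not_odd_iff_even.2 hyj hzodd
        · rw [Pi.add_apply, Pi.single_eq_of_ne (Ne.symm haj), add_zero] at hzodd; exact Int.not_odd_iff_even.2 hyj hzodd
        · exact Int.not_odd_iff_even.2 hyj hzodd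
      have hab_ij : a = i ∧ b = j := by
        rcases hzq' with ⟨hai, _⟩ | ⟨hbi, _⟩
        · refine ⟨hai, ?_⟩
          by_contra hbj
          exact hzj_y (fun h => hij' (hai.symm.trans h)) hbj
        · exfalso
          -- `b = i` and `a < b = i < j` so `a ≠ j`, `b ≠ j`
          exact hzj_y (fun h => by subst h; subst hbi; omega) (fun h => hij' (hbi.symm.trans h))
      obtain ⟨hai, hbj⟩ := hab_ij
      have hia : i = a := hai.symm
      have hjb : j = b := hbj.symm
      subst hia; subst hjb
      -- now `q = (y; i, j)` and `(z, i) ∈ q`: `z = y` or `z = y + e_j`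
      have hzy : z = y ∨ z = y + Pi.single j 1 := by
        rcases hzq' with ⟨-, h⟩ | ⟨hji, -⟩
        · exact h
        · exact absurd hji (Ne.symm hij')
      -- `y_i = x_i` (both `z = x + …e_j` and `z = y + …e_j`)
      have hyx_i : y i = x i := by
        have h1 : z i = x i := by
          rcases hz with rfl | rfl
          · rfl
          · rw [Pi.add_apply, Pi.single_eq_of_ne hij', add_zero]
        have h2 : z i = y i := by
          rcases hzy with rfl | rfl
          · rfl
          · rw [Pi.add_apply, Pi.single_eq_of_ne hij', add_zero]
        omega
      -- STEP 2: the free `j`-link of `q` is `(w', j)` with `w' ∈ {y, y + e_i}`, `w'_i` odd; since `y_i = x_i`, `w' = w + (y - x)` i.e. `w'` differs from `w` by `± e_j`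
      obtain ⟨w', hw', fw', hw'odd⟩ := free_link_of_axis_pair (Ne.symm hij') hqb
      have mw' : ((w', j) : ZdEdge 4) ∈ plaquetteEdges ((y, ⟨(i, j), hab⟩) : ZdPlaquette 4) := by
        simp only [plaquetteEdges, mem_insert, mem_singleton]
        rcases hw' with rfl | rfl
        · exact Or.inr (Or.inr (Or.inr rfl))
        · exact Or.inr (Or.inl rfl)
      -- the offsets `w - x` and `w' - y` agree (both `ε e_i` with the parity of `x_i = y_i` deciding `ε`)
      have hoff : (w = x ∧ w' = y) ∨ (w = x + Pi.single i 1 ∧ w' = y + Pi.single i 1) := by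
        rcases hw with rfl | rfl <;> rcases hw' with rfl | rfl
        · exact Or.inl ⟨rfl, rfl⟩
        · exfalso; rw [Pi.add_apply, Pi.single_eq_same, hyx_i] at hw'odd
          exact Int.not_even_iff_odd.2 hw'odd (hwodd.add_one)
        · exfalso; rw [Pi.add_apply, Pi.single_eq_same, ← hyx_i] at hwodd
          exact Int.not_even_iff_odd.2 hwodd (hw'odd.add_one)
        · exact Or.inr ⟨rfl, rfl⟩
      -- `y = x ± e_j` with `y ≠ x` (else `q = p`)
      have hyx : y ≠ x := by
        rintro rfl; exact hqp rfl
      have hshift : y = x + Pi.single j 1 ∨ x = y + Pi.single j 1 := by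
        rcases hz with rfl | rfl <;> rcases hzy with h | h
        · exact absurd h.symm hyx
        · exact Or.inr h
        · exact Or.inl h.symm
        · exact absurd (add_right_cancel h).symm hyx
      -- STEP 3: `(w', j)` lies in a second member; not in `p` (its `j`-coordinate differs from `x_j`), so in `r`, together with `(w, j)`: two parallel `j`-links one step apart
      obtain ⟨s, hsX, hsq, hw's⟩ := exists_host hcl hqX mw' fw'
      -- `(w', j) ∉ p`
      have hw'p : ((w', j) : ZdEdge 4) ∉ plaquetteEdges ((x, ⟨(i, j), hij⟩) : ZdPlaquette 4) := by
        intro hm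
        rw [mk_mem_plaquetteEdges_iff] at hm
        dsimp only at hm
        rcases hm with ⟨hji, -⟩ | ⟨-, hm⟩
        · exact hij' hji
        · -- `w' = x + e_i` or `w' = x`; but `w'_j = y_j = x_j ± 1`
          have hw'j : w' j = y j := by
            rcases hw' with rfl | rfl
            · rfl
            · rw [Pi.add_apply, Pi.single_eq_of_ne (Ne.symm hij'), add_zero]
          have hxj : w' j = x j := by
            rcases hm with rfl | rfl
            · rw [Pi.add_apply, Pi.single_eq_of_ne (Ne.symm hij'), add_zero]
            · rfl
          rcases hshift with h | h
          · have := congrFun h j; rw [Pi.add_apply, Pi.single_eq_same] at this; omega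
          · have := congrFun h j; rw [Pi.add_apply, Pi.single_eq_same] at this; omega
      -- hence `s = r`: `s ∈ X = {p, q, r}`, `s ≠ q`, `s ≠ p`
      have hsp : s ≠ ((x, ⟨(i, j), hij⟩) : ZdPlaquette 4) := fun h => hw'p (h ▸ hw's)
      have hsr : s = r := by
        by_contra hsr
        have hsub : ({((x, ⟨(i, j), hij⟩) : ZdPlaquette 4), ((y, ⟨(i, j), hab⟩) : ZdPlaquette 4), r, s} : Finset (ZdPlaquette 4)) ⊆ X := by
          intro t ht; simp only [mem_insert, mem_singleton] at ht
          rcases ht with rfl | rfl | rfl | rfl <;> assumption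
        have hcard : ({((x, ⟨(i, j), hij⟩) : ZdPlaquette 4), ((y, ⟨(i, j), hab⟩) : ZdPlaquette 4), r, s} : Finset (ZdPlaquette 4)).card = 4 := by
          rw [card_insert_of_notMem, card_insert_of_notMem, card_insert_of_notMem, card_singleton]
          · simpa using (Ne.symm hsr)
          · simp only [mem_insert, mem_singleton, not_or]; exact ⟨hqr, hsq.symm⟩
          · simp only [mem_insert, mem_singleton, not_or]; exact ⟨hqp.symm, hrp.symm, hsp.symm⟩
        have := card_le_card hsub
        omega
      subst hsr
      -- two parallel `j`-links of `s = r` one step apart in direction `j`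
      rcases hoff with ⟨hw1, hw'1⟩ | ⟨hw1, hw'1⟩
      · rw [hw1] at hwr; rw [hw'1] at hw's
        rcases hshift with h | h
        · exact not_mem_parallel_shift s x j ⟨hwr, by rw [← h]; exact hw's⟩
        · exact not_mem_parallel_shift s y j ⟨hw's, by rw [← h]; exact hwr⟩
      · rw [hw1] at hwr; rw [hw'1] at hw's
        rcases hshift with h | h
        · refine not_mem_parallel_shift s (x + Pi.single i 1) j ⟨hwr, ?_⟩
          rw [add_assoc, add_comm (Pi.single i 1), ← add_assoc, ← h]; exact hw's
        · refine not_mem_parallel_shift s (y + Pi.single i 1) j ⟨hw's, ?_⟩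
          rw [add_assoc, add_comm (Pi.single i 1), ← add_assoc, ← h]; exact hwr⟩
  exact Nat.card_of_isEmpty

/-- ★ `freePolymerCount f n = 0` for every `n ≤ 3` and every link `f`. [folklore] -/
theorem freePolymerCount_eq_zero_of_le_three (f : ZdEdge 4) {n : ℕ} (hn : n ≤ 3) : freePolymerCount f n = 0 := by
  rcases Nat.lt_or_ge n 3 with h | h
  · exact freePolymerCount_eq_zero_of_le_two f (by omega)
  · have : n = 3 := by omega
    subst this
    exact freePolymerCount_three f

end Summit.QuantumFields.YangMills.Theorems.Instrument.FreePolymerThreeZero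

end
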